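import Summits.BirchSwinnertonDyer.BirchSwinnertonDyer.Theorems.ByReductionTypeAtTwoRankOneSprungEtaBridgeAtTwo
import HarnessLib

/-!
# The ♯/♭ ↔ η dictionary on shared data: given the bridge `‖Λ_η‖ = ¼‖PR‖` (B56), the 56A valuation identity and the K2-Vss norm
# identity are EQUIVALENT curve by curve (all PROVED; pure bookkeeping)

Cell `bsd-f1-sign2`, seat `-an` g52 (MEMO-an §56.10), crux `stmt-BirchSwinnertonDyer-23715`; helper file, closes nothing, asserts nothing new
(no `@[conjecture]` here).

For ONE curve `W` with its shared auxiliary data — a Sprung pair `(L♯, L♭)`, the `D`-valued derivative vector `L` and Katz entry `v`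
(so `Λ_η = ssLeadingEta W 2 L v`), a rational point `P` read through `ι : ℚ →+* ℚ₂`, a period ratio `ϖ ≠ 0` — and under the
bridge instance `‖Λ_η‖₂ = ¼·‖PR‖₂` (B56 `SprungEtaBridgeAtTwo` of `…SprungEtaBridgeAtTwo`), `PR ≠ 0`, `log_ω(P) ≠ 0`, odd `#E(ℚ)_tors`:
* `norm_eq_iff_valuation_eq` — in `ℚ_[p]`, for non-zero `x, y`: `‖x‖ = ‖y‖ ↔ v(x) = v(y)`;
* `etaNorm_iff_prValuation` — the pure-`ℚ₂` bookkeeping: `‖ϖ·Λ·m²‖ = ‖s·lg²·t‖ ↔ v(PR) = v s + v t − v ϖ + 2ℓ − 2` (`m` odd, `v(lg) = ℓ`,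
  `v(Λ) = v(PR) + 2`);
* `twoAdicEtaVal_iff_perrinRiouShaOrder` — THE DICTIONARY: the K2-Vss identity
  `‖ϖ · Λ_η · #tors²‖₂ = ‖#Ш[2^∞] · log_ω(P)² · Tam‖₂` (`Rank1Residual.F1Sign2.TwoAdicBSDEtaValRankOneSs`, -es) holds iff the 56A identity
  `v₂(PR) = v₂ #Ш[2^∞] + v₂ Tam − v₂ ϖ + 2·padicLogOrd W 2 ι P − 2` (`PerrinRiouShaOrderAtTwo`, -an) holds — the log-symbol
  compatibility `padicLogOrd W 2 ι P = v₂(logOmegaAt W 2 P)` entering as a binder, discharged by `…LogCompatAtTwo.padicLogOrd_eq_valuation_logOmegaAt`;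
* `odd_index_zmultiples_of_isMordellWeilBasis` — for a one-element Mordell–Weil basis `P₀` and odd `#E(ℚ)_tors`, the index `[E(ℚ) : ℤ·P₀ 0]` is odd
  (it divides `#E(ℚ)_tors`: `E(ℚ)_tors ↠ E(ℚ)/ℤP₀`), so the -es binder `IsMordellWeilBasis P₀` on the slice supplies the -an binders
  `¬ IsOfFinAddOrder (P₀ 0)` and `Odd [E(ℚ) : ℤ·(P₀ 0)]` (with `exists_eq_zsmul_zero_add_torsion_of_isMordellWeilBasis`; cf. the `fun _ ↦ Q`
  forms in `Rank1Residual/Additive/CyclotomicThreeRankOneDescentData`).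
NOT done here (next generation): the closed implication between the two `Prop`s needs a Katz column in the D51-K dialect (`IsKatzColumnAtTwo`, a
vestigial binder of 56A) from the -es dialect (`IsKatzFrobeniusColumn W 2`) and the non-degeneracy inputs (`PR ≠ 0` = 55A′, `log_ω ≠ 0`).
BSD is not proved by any of this; 23715 is not closed.  References: [cite: SilvermanAEC2009, VIII.6] [cite: KuriharaPollack2007, (9)–(11)]
[cite: Sprung2017, (1.2)].
-/

set_option linter.unusedSectionVars false

namespace Summit.BirchSwinnertonDyer.BirchSwinnertonDyer.Theorems.PerrinRiouElementAtTwo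

open scoped Classical MatrixGroups ModularForm
open CongruenceSubgroup PowerSeries WeierstrassCurve Literature.NumberTheory.EllipticCurves Literature.NumberTheory.EllipticCurves.ModularForms
  Literature.NumberTheory.EllipticCurves.Sprung2017 Literature.NumberTheory.EllipticCurves.Rank1Residual
  Summit.BirchSwinnertonDyer.Rank1Residual.F1Sign2

/-! ### §1 Pure `ℚ_p` bookkeeping -/

/-- In `ℚ_[p]`, two non-zero elements have the same norm iff they have the same valuation. [folklore] -/
theorem norm_eq_iff_valuation_eq {p : ℕ} [Fact p.Prime] {x y : ℚ_[p]} (hx : x ≠ 0) (hy : y ≠ 0) :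
    ‖x‖ = ‖y‖ ↔ x.valuation = y.valuation := by
  rw [Padic.norm_eq_zpow_neg_valuation hx, Padic.norm_eq_zpow_neg_valuation hy]
  have hp1 : (1 : ℝ) < p := by exact_mod_cast (Fact.out : p.Prime).one_lt
  constructor
  · intro h
    have := zpow_right_injective₀ (by linarith) hp1.ne' h
    omega
  · intro h; rw [h]

/-- The bookkeeping behind the dictionary: with `‖Λ‖ = ¼‖PR‖`, `PR ≠ 0`, `ϖ ≠ 0`, `s, t ≠ 0`, `m` odd, `lg ≠ 0` of valuation `ℓ`,
`‖ϖ·Λ·m²‖₂ = ‖s·lg²·t‖₂ ↔ v₂(PR) = v₂ s + v₂ t − v₂ ϖ + 2ℓ − 2`. [folklore] -/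
theorem etaNorm_iff_prValuation {Λ PR lg : ℚ_[2]} {ϖ : ℚ} {s t m : ℕ} {ℓ : ℤ}
    (hbr : ‖Λ‖ = 4⁻¹ * ‖PR‖) (hPR : PR ≠ 0) (hϖ : ϖ ≠ 0) (hs : s ≠ 0) (ht : t ≠ 0) (hm : Odd m)
    (hlg : lg ≠ 0) (hℓ : lg.valuation = ℓ) :
    ‖(ϖ : ℚ_[2]) * Λ * (m : ℚ_[2]) ^ 2‖ = ‖(s : ℚ_[2]) * lg ^ 2 * (t : ℚ_[2])‖ ↔
      PR.valuation = (padicValNat 2 s : ℤ) + (padicValNat 2 t : ℤ) - padicValRat 2 ϖ + 2 * ℓ - 2 := by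
  obtain ⟨hΛ0, hΛv⟩ := valuation_eq_add_two_of_norm_eq hPR hbr
  have hϖ0 : (ϖ : ℚ_[2]) ≠ 0 := by exact_mod_cast hϖ
  have hm0' : m ≠ 0 := by rintro rfl; exact absurd hm (by decide)
  have hm0 : (m : ℚ_[2]) ≠ 0 := by exact_mod_cast hm0'
  have hs0 : (s : ℚ_[2]) ≠ 0 := by exact_mod_cast hs
  have ht0 : (t : ℚ_[2]) ≠ 0 := by exact_mod_cast ht
  have hL0 : (ϖ : ℚ_[2]) * Λ * (m : ℚ_[2]) ^ 2 ≠ 0 := mul_ne_zero (mul_ne_zero hϖ0 hΛ0) (pow_ne_zero _ hm0)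
  have hR0 : (s : ℚ_[2]) * lg ^ 2 * (t : ℚ_[2]) ≠ 0 := mul_ne_zero (mul_ne_zero hs0 (pow_ne_zero _ hlg)) ht0
  have hvm : (m : ℚ_[2]).valuation = 0 := by
    rw [Padic.valuation_natCast]
    have : padicValNat 2 m = 0 := padicValNat.eq_zero_of_not_dvd (by obtain ⟨j, hj⟩ := hm; omega)
    exact_mod_cast this
  rw [norm_eq_iff_valuation_eq hL0 hR0, Padic.valuation_mul (mul_ne_zero hϖ0 hΛ0) (pow_ne_zero _ hm0),
    Padic.valuation_mul hϖ0 hΛ0, Padic.valuation_mul (mul_ne_zero hs0 (pow_ne_zero _ hlg)) ht0,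
    Padic.valuation_mul hs0 (pow_ne_zero _ hlg), Padic.valuation_pow, Padic.valuation_pow, hvm, hΛv, hℓ,
    Padic.valuation_ratCast, Padic.valuation_natCast, Padic.valuation_natCast]
  push_cast
  constructor <;> intro h <;> linarith

/-! ### §2 The dictionary on curve data -/

/-- **THE ♯/♭ ↔ η DICTIONARY (curve by curve).**  For a curve `W` with shared data and under the bridge instance `‖Λ_η‖₂ = ¼‖PR‖₂`,
`PR ≠ 0`, `ϖ ≠ 0`, `log_ω(P) ≠ 0`, odd `#E(ℚ)_tors`, `Tam ≠ 0` and `Ш[2^∞]` finite: the K2-Vss norm identity (η currency, -es) holds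
iff the 56A valuation identity (♯/♭ currency, -an; `padicLogOrd` read through any `ι`) holds.  The binder `hℓ` (the two cells' log symbols
agree) is discharged by `padicLogOrd_eq_valuation_logOmegaAt W ι P hlog` of `…Theorems.ByReductionTypeAtTwoRankOneLogCompatAtTwo` (PROVED;
kept as a binder only because that module post-dates this file's build snapshot). [folklore] -/
theorem twoAdicEtaVal_iff_perrinRiouShaOrder (W : WeierstrassCurve ℚ) [W.IsElliptic] [W.IsGloballyMinimal]
    {Lsharp Lflat : IwasawaAlgebra 2} {L : Fin 2 → ℚ_[2]} {v : ℚ_[2]} {ϖ : ℚ} (ι : ℚ →+* ℚ_[2]) (P : W.toAffine.Point)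
    (hbr : ‖ssLeadingEta W 2 L v‖ = 4⁻¹ * ‖prComb (W.frobeniusTrace 2) Lsharp Lflat‖)
    (hPR : prComb (W.frobeniusTrace 2) Lsharp Lflat ≠ 0) (hϖ : ϖ ≠ 0) (hT : Odd W.torsionOrder) (hTam : W.tamagawaProduct ≠ 0)
    (hfin : Finite (AddCommGroup.primaryComponent W.sha 2)) (hlog : logOmegaAt W 2 P ≠ 0)
    (hℓ : padicLogOrd W 2 ι (K := ℚ) P = (logOmegaAt W 2 P).valuation) :
    ‖(ϖ : ℚ_[2]) * ssLeadingEta W 2 L v * (W.torsionOrder : ℚ_[2]) ^ 2‖ =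
        ‖(Nat.card (AddCommGroup.primaryComponent W.sha 2) : ℚ_[2]) * (logOmegaAt W 2 P) ^ 2 * W.tamagawaProduct‖ ↔
      (prComb (W.frobeniusTrace 2) Lsharp Lflat).valuation =
        (padicValNat 2 (Nat.card (AddCommGroup.primaryComponent W.sha 2)) : ℤ) +
          (padicValNat 2 W.tamagawaProduct : ℤ) - padicValRat 2 ϖ + 2 * padicLogOrd W 2 ι (K := ℚ) P - 2 := by
  haveI := hfin
  have hs : Nat.card (AddCommGroup.primaryComponent W.sha 2) ≠ 0 := Nat.card_pos.ne'
  exact etaNorm_iff_prValuation hbr hPR hϖ hs hTam hT hlog hℓ.symm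

/-! ### §3 The -es binder `IsMordellWeilBasis P₀` supplies the -an binders -/

section Basis

variable {F : Type*} [Field F] {E : WeierstrassCurve F} {P₀ : Fin 1 → E.toAffine.Point}

/-- A one-element Mordell–Weil basis `P₀ : Fin 1 → E(F)` has `P₀ 0` of infinite order (cf. the `fun _ ↦ Q` form
`Rank1Residual.Additive.not_isOfFinAddOrder_of_isMordellWeilBasis_one`). [folklore] -/
theorem not_isOfFinAddOrder_zero_of_isMordellWeilBasis (hP : IsMordellWeilBasis P₀) : ¬ IsOfFinAddOrder (P₀ 0) := by
  intro hfin
  apply hP.1.ne_zero (0 : Fin 1)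
  simp only [Function.comp_apply]
  exact (QuotientAddGroup.eq_zero_iff _).mpr ((AddCommGroup.mem_torsion _).mpr hfin)

/-- Every point is an integer multiple of `P₀ 0` up to torsion, for a one-element Mordell–Weil basis `P₀`. [folklore] -/
theorem exists_eq_zsmul_zero_add_torsion_of_isMordellWeilBasis (hP : IsMordellWeilBasis P₀) (g : E.toAffine.Point) :
    ∃ (m : ℤ) (t : E.toAffine.Point), IsOfFinAddOrder t ∧ g = m • P₀ 0 + t := by
  have hrange : Set.range (QuotientAddGroup.mk ∘ P₀ : Fin 1 → mordellWeilModTorsion E) = {QuotientAddGroup.mk (P₀ 0)} := by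
    ext x
    simp only [Set.mem_range, Set.mem_singleton_iff, Function.comp_apply]
    constructor
    · rintro ⟨i, rfl⟩; rw [Subsingleton.elim i 0]
    · rintro rfl; exact ⟨0, rfl⟩
  have hmem : (QuotientAddGroup.mk g : mordellWeilModTorsion E) ∈
      Submodule.span ℤ (Set.range (QuotientAddGroup.mk ∘ P₀ : Fin 1 → mordellWeilModTorsion E)) := by
    rw [hP.2]; exact Submodule.mem_top
  rw [hrange, Submodule.mem_span_singleton] at hmem
  obtain ⟨m, hm⟩ := hmem
  refine ⟨m, g - m • P₀ 0, ?_, by abel⟩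
  have h0 : (QuotientAddGroup.mk (g - m • P₀ 0) : mordellWeilModTorsion E) = 0 := by
    rw [QuotientAddGroup.mk_sub, QuotientAddGroup.mk_zsmul, hm, sub_self]
  exact (AddCommGroup.mem_torsion _).mp ((QuotientAddGroup.eq_zero_iff _).mp h0)

/-- For a one-element Mordell–Weil basis `P₀`, the index `[E(F) : ℤ·P₀ 0]` divides `#E(F)_tors` (the torsion subgroup surjects onto
`E(F)/ℤ·P₀ 0`). [folklore] -/
theorem index_zmultiples_dvd_torsionOrder_of_isMordellWeilBasis (hP : IsMordellWeilBasis P₀) :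
    (AddSubgroup.zmultiples (P₀ 0)).index ∣ E.torsionOrder := by
  set H := AddSubgroup.zmultiples (P₀ 0) with hH
  set T := AddCommGroup.torsion E.toAffine.Point with hTdef
  let φ : T →+ E.toAffine.Point ⧸ H := (QuotientAddGroup.mk' H).comp T.subtype
  have hφ : Function.Surjective φ := by
    intro x
    obtain ⟨g, rfl⟩ := QuotientAddGroup.mk_surjective x
    obtain ⟨m, t, ht, hg⟩ := exists_eq_zsmul_zero_add_torsion_of_isMordellWeilBasis hP g
    refine ⟨⟨t, (AddCommGroup.mem_torsion _).mpr ht⟩, ?_⟩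
    show QuotientAddGroup.mk t = QuotientAddGroup.mk g
    rw [QuotientAddGroup.eq, hg]
    have hsimp : -t + (m • P₀ 0 + t) = m • P₀ 0 := by abel
    rw [hsimp]
    exact AddSubgroup.zsmul_mem_zmultiples _ m
  have hdvd : Nat.card (E.toAffine.Point ⧸ H) ∣ Nat.card T := AddSubgroup.card_dvd_of_surjective φ hφ
  simpa [WeierstrassCurve.torsionOrder, AddSubgroup.index] using hdvd

/-- Hence on the 23715 slice (odd `#E(ℚ)_tors`) the index `[E(ℚ) : ℤ·P₀ 0]` of a one-element Mordell–Weil basis is odd — the -an binder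
`Odd (AddSubgroup.zmultiples P).index` of 55A/55B/56A at `P := P₀ 0`. [folklore] -/
theorem odd_index_zmultiples_of_isMordellWeilBasis (hP : IsMordellWeilBasis P₀) (hT : Odd E.torsionOrder) :
    Odd (AddSubgroup.zmultiples (P₀ 0)).index :=
  hT.of_dvd_nat (index_zmultiples_dvd_torsionOrder_of_isMordellWeilBasis hP)

end Basis

end Summit.BirchSwinnertonDyer.BirchSwinnertonDyer.Theorems.PerrinRiouElementAtTwo
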